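import Summits.AtomisticToContinuum.HydrodynamicLimit.Theses.JParityClosure
import HarnessLib

/-!
# Vanishing of the even entropy production under detailed balance
(stub `stub_productionZeroOfDetailedBalance`)

Helper for the line `Sketch` of the crux `JParityClosure.ParityBandClosure`
(stmt-AtomisticToContinuum-17608), sub-goal of the skeleton stub `stub_isotropyOfMaxwellDefect`.

WHAT. Let `m` be a finite measure on `V3`, `F : S² → V3 × V3 → ℝ` jointly measurable (the
surprisal jump), and `B(q) = ((w − v)·ω)₊ = hardSphereKernel (w, v) ω` the flux weight at the
collision record `q = ((v, w), ω)`. ASSUME detailed balance for the ideal contact law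
`π = B · (m ⊗ m ⊗ σ)`, i.e. `F = 0` `π`-a.e. THEN the even production
`∫⁻ (v, w) ∫⁻ ω B · F · (1 − e^{−F}) dσ d(m ⊗ m)` vanishes.

PROOF. The Tonelli bridge. (1) `ae_withDensity_iff`: the hypothesis reads
`∀ᵐ q ∂(m ⊗ m ⊗ σ), B q ≠ 0 → F q = 0` (the density `ofReal ∘ B` is measurable since `B` is
continuous). (2) Hence the integrand `ofReal (B · (F · (1 − e^{−F})))` vanishes
`(m ⊗ m ⊗ σ)`-a.e.: where `B = 0` the product is `0`, where `B ≠ 0` (so `B > 0`, `B ≥ 0` being a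
positive part) `F = 0` and `1 − e^0 = 0`. (3) `lintegral_congr_ae` + `lintegral_zero` give the
vanishing of the joint integral, and Tonelli (`lintegral_prod`, `σ` finite hence s-finite, the
integrand measurable) identifies it with the iterated integral of the conclusion.

REFERENCES. C. Cercignani, R. Illner, M. Pulvirenti, *The Mathematical Theory of Dilute Gases*,
1994, §3.2 (the equality case of the H-theorem: detailed balance kills the entropy production).
-/

noncomputable section

namespace Summit.AtomisticToContinuum.HydrodynamicLimit.Theorems.ParityBandClosureIsotropy

open scoped BigOperators ENNReal
open MeasureTheory
open Literature.MathematicalPhysics.KineticTheory Literature.Analysis.FluidPDE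

/-- The flux weight `q = ((v, w), ω) ↦ ((w − v)·ω)₊ = hardSphereKernel (w, v) ω` is continuous on
the collision-record space `(V3 × V3) × S²`. [folklore] -/
theorem continuous_fluxWeight :
    Continuous (fun q : (V3 × V3) × Metric.sphere (0 : V3) 1 =>
      hardSphereKernel (q.1.2, q.1.1) q.2) := by
  unfold hardSphereKernel
  fun_prop

/-- The flux weight `q = ((v, w), ω) ↦ hardSphereKernel (w, v) ω` is measurable on the
collision-record space `(V3 × V3) × S²`. [folklore] -/
theorem measurable_fluxWeight :
    Measurable (fun q : (V3 × V3) × Metric.sphere (0 : V3) 1 =>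
      hardSphereKernel (q.1.2, q.1.1) q.2) :=
  continuous_fluxWeight.measurable

/-- The flux weight is nonnegative: `0 ≤ hardSphereKernel p ω` (it is a positive part).
[folklore] -/
theorem fluxWeight_nonneg (p : V3 × V3) (ω : Metric.sphere (0 : V3) 1) :
    0 ≤ hardSphereKernel p ω := by
  unfold hardSphereKernel
  exact le_max_right _ _

/-- Pointwise vanishing of the production integrand: if `b ≥ 0` and `ofReal b ≠ 0` forces `x = 0`,
then `ofReal (b · (x · (1 − e^{−x}))) = 0`. [folklore] -/
theorem ofReal_mul_mul_one_sub_exp_neg_eq_zero {b x : ℝ} (hb : 0 ≤ b)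
    (h : ENNReal.ofReal b ≠ 0 → x = 0) :
    ENNReal.ofReal (b * (x * (1 - Real.exp (-x)))) = 0 := by
  rcases hb.lt_or_eq with hpos | hzero
  · rw [h (ENNReal.ofReal_ne_zero_iff.2 hpos), neg_zero, Real.exp_zero, sub_self, mul_zero,
      mul_zero, ENNReal.ofReal_zero]
  · rw [← hzero, zero_mul, ENNReal.ofReal_zero]

/-- **STUB `stub_productionZeroOfDetailedBalance` (line `Sketch`, crux `ParityBandClosure`,
stmt-17608): detailed balance kills the even entropy production.** For a finite measure `m` on
`V3` and a jointly measurable surprisal jump `F : S² → V3 × V3 → ℝ`, if `F = 0` almost everywhere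
for the ideal contact law `((w − v)·ω)₊ · (m ⊗ m ⊗ σ)`, then
`∫⁻ (v, w) ∫⁻ ω ((w − v)·ω)₊ · F · (1 − e^{−F}) dσ d(m ⊗ m) = 0`
(`ae_withDensity_iff` + pointwise vanishing + Tonelli `lintegral_prod`). [folklore] -/
theorem stub_productionZeroOfDetailedBalance : ∀ (m : Measure V3) (F : Metric.sphere (0 : V3) 1 → V3 × V3 → ℝ), IsFiniteMeasure m → Measurable (Function.uncurry F) → (∀ᵐ q ∂(((m.prod m).prod sphereMeasure).withDensity (fun q => ENNReal.ofReal (hardSphereKernel (q.1.2, q.1.1) q.2))), F q.2 q.1 = 0) → (∫⁻ p, ∫⁻ ω, ENNReal.ofReal (hardSphereKernel (p.2, p.1) ω * (F ω p * (1 - Real.exp (-F ω p)))) ∂sphereMeasure ∂(m.prod m)) = 0 := by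
  intro m F _ hF hae
  haveI : IsFiniteMeasure (sphereMeasure : Measure (Metric.sphere (0 : V3) 1)) := by
    unfold sphereMeasure; infer_instance
  -- (1) unfold the density: `B q ≠ 0 → F q = 0` a.e. for the product reference measure
  have hg : Measurable (fun q : (V3 × V3) × Metric.sphere (0 : V3) 1 =>
      ENNReal.ofReal (hardSphereKernel (q.1.2, q.1.1) q.2)) :=
    measurable_fluxWeight.ennreal_ofReal
  rw [ae_withDensity_iff hg] at hae
  -- measurability of `q ↦ F q.2 q.1 = uncurry F (q.2, q.1)` and of the production integrand
  have hF' : Measurable (fun q : (V3 × V3) × Metric.sphere (0 : V3) 1 => F q.2 q.1) :=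
    hF.comp (measurable_snd.prodMk measurable_fst)
  have hG : Measurable (fun q : (V3 × V3) × Metric.sphere (0 : V3) 1 =>
      ENNReal.ofReal (hardSphereKernel (q.1.2, q.1.1) q.2 *
        (F q.2 q.1 * (1 - Real.exp (-F q.2 q.1))))) :=
    (measurable_fluxWeight.mul (hF'.mul (measurable_const.sub
      (Real.measurable_exp.comp hF'.neg)))).ennreal_ofReal
  -- (2) the integrand vanishes a.e., (3) Tonelli
  calc ∫⁻ p, ∫⁻ ω, ENNReal.ofReal (hardSphereKernel (p.2, p.1) ω *
          (F ω p * (1 - Real.exp (-F ω p)))) ∂sphereMeasure ∂(m.prod m)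
      = ∫⁻ q, ENNReal.ofReal (hardSphereKernel (q.1.2, q.1.1) q.2 *
          (F q.2 q.1 * (1 - Real.exp (-F q.2 q.1)))) ∂((m.prod m).prod sphereMeasure) :=
        (lintegral_prod _ hG.aemeasurable).symm
    _ = ∫⁻ _, 0 ∂((m.prod m).prod sphereMeasure) :=
        lintegral_congr_ae (hae.mono fun q hq =>
          ofReal_mul_mul_one_sub_exp_neg_eq_zero (fluxWeight_nonneg _ _) hq)
    _ = 0 := lintegral_zero

end Summit.AtomisticToContinuum.HydrodynamicLimit.Theorems.ParityBandClosureIsotropy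

end
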